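import Mathlib
import HarnessLib
import Summits.HubbardSuperconductivity.HubbardSuperconductivity.Theorems.KLProgrammeKLRegimeTwoVolumeSubstitutionPushforward

/-!
# Route `KLProgramme` — crux K3, the nested two-volume pass: LIPSCHITZ DEPENDENCE OF A LINEAR SUBSTITUTION ON ITS MATRIX at the level of pinned
# kernel profiles (bracket (ii) of the OWN-FRAME organisation of the inductive two-volume comparison; cell gate-hubbard-kl, seat hubbard-kl-k3c4-p1 g11;
# `--supports` stmt-HubbardSuperconductivity-20440)

In the inductive two-volume comparison of the VL child `KLRegimeVolumeLimitV17F2` each volume's tower runs at ITS OWN flow frame (the engine's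
weighted profiles `KernelNormsWt4 … (klFlowFrameU L M β U μ n) j` are supplied at that frame only).  At every scale the fine volume's re-sectorisation /
analysis substitution `map (toLin' T₁)` (built on the band of its own frame `K_{L″}`) is compared with the one built on the coarse volume's frame `K_L`,
`map (toLin' T₂)`, applied to the SAME one-volume element `D`; the two matrices differ by `O(1/L)` in row and column mass.  This file is that bracket,
generic in the label types:

* §1 `norm_prod_sub_prod_le_sum_mul_prod_erase` — telescoping with LEG-WISE majorants: `‖f i‖, ‖g i‖ ≤ M i` ⇒
  `‖∏ f − ∏ g‖ ≤ Σ_j ‖f j − g j‖ · ∏_{i ≠ j} M i`;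
* §2 **`sum_pinned_norm_kernel_map_sub_map_le`** — for matrices `T₁, T₂` with a common entrywise majorant `Tm` of column sums `≤ a` and pin row `≤ a`,
  whose DIFFERENCE has column sums and pin row `≤ δ`, and an element `D` with pinned profile `≤ ND` in degree `n+1` (leg `p`):
  `Σ_{X : X_p = w} ‖kernel (map T₁ D) (n+1) X − kernel (map T₂ D) (n+1) X‖ ≤ (n+1)·aⁿ·δ·ND`;
  `sum_pinned_norm_kernel_map_sub_map_le'` — the same for `kernel (map T₁ D − map T₂ D)`.

Everything is proved; no definition; model-free.  Ingredients: `GrassmannLinearSubstitution.kernel_map`, `…SubstitutionGluing.sum_pinned_prod_eq`,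
`…SubstitutionGluingBound.sum_mul_apply_leg_le / prod_le_pow_card_of_le / card_univ_erase_fin / card_univ_erase_erase_fin`.
References: Salmhofer 1999 §4.3 (finite-volume bookkeeping of kernels under linear maps of the fields); BGM 2006 §2.7 (2.70)–(2.71a).
-/

noncomputable section

namespace Summit.HubbardSuperconductivity.HubbardSuperconductivity.Theorems.TwoVolumeDefect

set_option linter.dupNamespace false -- summit = problem name (single-conjunct summit), D-0017

open Finset Literature.MathematicalPhysics.QuantumLattice GrassmannAlgebra

/-! ## §1 Telescoping a difference of products against leg-wise majorants -/

/-- **Telescoping with leg-wise majorants**: in a commutative normed ring, if `‖f i‖ ≤ M i` and `‖g i‖ ≤ M i` on `s`, then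
`‖∏_{i ∈ s} f i − ∏_{i ∈ s} g i‖ ≤ Σ_{j ∈ s} ‖f j − g j‖ · ∏_{i ∈ s.erase j} M i`. [folklore] -/
theorem norm_prod_sub_prod_le_sum_mul_prod_erase {R : Type*} [NormedCommRing R] [NormOneClass R] {α : Type*} [DecidableEq α]
    (s : Finset α) {f g : α → R} {M : α → ℝ} (hf : ∀ i ∈ s, ‖f i‖ ≤ M i) (hg : ∀ i ∈ s, ‖g i‖ ≤ M i) :
    ‖∏ i ∈ s, f i - ∏ i ∈ s, g i‖ ≤ ∑ j ∈ s, ‖f j - g j‖ * ∏ i ∈ s.erase j, M i := by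
  induction s using Finset.induction_on with
  | empty => simp
  | @insert a s ha ih =>
    have hfa : ‖f a‖ ≤ M a := hf a (mem_insert_self a s)
    have hga : ‖g a‖ ≤ M a := hg a (mem_insert_self a s)
    have hfs : ∀ i ∈ s, ‖f i‖ ≤ M i := fun i hi => hf i (mem_insert_of_mem hi)
    have hgs : ∀ i ∈ s, ‖g i‖ ≤ M i := fun i hi => hg i (mem_insert_of_mem hi)
    have hM0 : ∀ i ∈ s, 0 ≤ M i := fun i hi => (norm_nonneg _).trans (hfs i hi)
    have hPf : ‖∏ i ∈ s, f i‖ ≤ ∏ i ∈ s, M i :=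
      (norm_prod_le s f).trans (prod_le_prod (fun i _ => norm_nonneg _) hfs)
    have ih' := ih hfs hgs
    -- the erased products over `insert a s`
    have hea : (insert a s).erase a = s := erase_insert ha
    have hej : ∀ j ∈ s, (insert a s).erase j = insert a (s.erase j) := fun j hj => by
      have hne : a ≠ j := by rintro rfl; exact ha hj
      rw [erase_insert_of_ne hne]
    rw [prod_insert ha, prod_insert ha, sum_insert ha, hea]
    have hsum : ∑ j ∈ s, ‖f j - g j‖ * ∏ i ∈ (insert a s).erase j, M i = M a * ∑ j ∈ s, ‖f j - g j‖ * ∏ i ∈ s.erase j, M i := by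
      rw [mul_sum]
      refine sum_congr rfl fun j hj => ?_
      rw [hej j hj, prod_insert (fun h => ha (mem_of_mem_erase h))]
      ring
    rw [hsum]
    have hMa : 0 ≤ M a := (norm_nonneg _).trans hfa
    calc ‖f a * ∏ i ∈ s, f i - g a * ∏ i ∈ s, g i‖
        = ‖(f a - g a) * ∏ i ∈ s, f i + g a * (∏ i ∈ s, f i - ∏ i ∈ s, g i)‖ := by congr 1; ring
      _ ≤ ‖f a - g a‖ * ‖∏ i ∈ s, f i‖ + ‖g a‖ * ‖∏ i ∈ s, f i - ∏ i ∈ s, g i‖ :=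
          (norm_add_le _ _).trans (add_le_add (norm_mul_le _ _) (norm_mul_le _ _))
      _ ≤ ‖f a - g a‖ * ∏ i ∈ s, M i + M a * ∑ j ∈ s, ‖f j - g j‖ * ∏ i ∈ s.erase j, M i := by
          have h0 : 0 ≤ ∑ j ∈ s, ‖f j - g j‖ * ∏ i ∈ s.erase j, M i :=
            sum_nonneg fun j _ => mul_nonneg (norm_nonneg _) (prod_nonneg fun i hi => hM0 i (mem_of_mem_erase hi))
          gcongr

/-! ## §2 The substitution-difference bracket at the level of pinned profiles -/

variable {𝕜 : Type*} [RCLike 𝕜] {Γ₁' Γ₂' : Type*} [Fintype Γ₁'] [DecidableEq Γ₁'] [Fintype Γ₂'] [DecidableEq Γ₂']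

/-- **LIPSCHITZ DEPENDENCE OF `map (toLin' T) D` ON `T` at the level of pinned kernel profiles.**  Let `T₁, T₂ : Matrix Γ₂′ Γ₁′ 𝕜` have a common
entrywise majorant `Tm` (`‖T₁ x y‖, ‖T₂ x y‖ ≤ Tm x y`) with column sums `Σ_x Tm x y ≤ a` and pin row `Σ_y Tm w y ≤ a`, let the difference have column sums
`Σ_x ‖T₁ x y − T₂ x y‖ ≤ δ` and pin row `Σ_y ‖T₁ w y − T₂ w y‖ ≤ δ`, and let `D` have pinned profile `Σ_{Y : Y_p = y} ‖kernel D (n+1) Y‖ ≤ ND` at every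
in-label `y`.  Then `Σ_{X : X_p = w} ‖kernel (map T₁ D) (n+1) X − kernel (map T₂ D) (n+1) X‖ ≤ (n+1)·aⁿ·δ·ND`. [folklore] -/
theorem sum_pinned_norm_kernel_map_sub_map_le (T₁ T₂ : Matrix Γ₂' Γ₁' 𝕜) (Tm : Γ₂' → Γ₁' → ℝ) (D : GrassmannAlgebra 𝕜 Γ₁') {n : ℕ}
    (p : Fin (n + 1)) (w : Γ₂') {a δ ND : ℝ} (ha : 0 ≤ a) (hδ : 0 ≤ δ) (hND0 : 0 ≤ ND)
    (hT₁ : ∀ x y, ‖T₁ x y‖ ≤ Tm x y) (hT₂ : ∀ x y, ‖T₂ x y‖ ≤ Tm x y)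
    (hcol : ∀ y, ∑ x, Tm x y ≤ a) (hrow : ∑ y, Tm w y ≤ a)
    (hδcol : ∀ y, ∑ x, ‖T₁ x y - T₂ x y‖ ≤ δ) (hδrow : ∑ y, ‖T₁ w y - T₂ w y‖ ≤ δ)
    (hND : ∀ y, ∑ Y ∈ univ.filter (fun Y : Fin (n + 1) → Γ₁' => Y p = y), ‖kernel 𝕜 D (n + 1) Y‖ ≤ ND) :
    ∑ X ∈ univ.filter (fun X : Fin (n + 1) → Γ₂' => X p = w),
        ‖kernel 𝕜 (ExteriorAlgebra.map (Matrix.toLin' T₁) D) (n + 1) X -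
          kernel 𝕜 (ExteriorAlgebra.map (Matrix.toLin' T₂) D) (n + 1) X‖ ≤ (n + 1) * a ^ n * δ * ND := by
  classical
  set Xp := univ.filter (fun X : Fin (n + 1) → Γ₂' => X p = w) with hXp
  have hTm0 : ∀ x y, 0 ≤ Tm x y := fun x y => (norm_nonneg _).trans (hT₁ x y)
  -- the leg-wise factors of the `j`-th telescoping term, for a fixed in-string `Y`
  set f : (Fin (n + 1) → Γ₁') → Fin (n + 1) → Fin (n + 1) → Γ₂' → ℝ :=
    fun Y j i x => if i = j then ‖T₁ x (Y i) - T₂ x (Y i)‖ else Tm x (Y i) with hf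
  have hf0 : ∀ Y j i x, 0 ≤ f Y j i x := by
    intro Y j i x; simp only [hf]; split_ifs; exacts [norm_nonneg _, hTm0 _ _]
  -- pointwise telescoping: `‖k(map T₁ D) X − k(map T₂ D) X‖ ≤ Σ_Y ‖kD Y‖ · Σ_j ∏_i f Y j i (X i)`
  have hpt : ∀ X : Fin (n + 1) → Γ₂',
      ‖kernel 𝕜 (ExteriorAlgebra.map (Matrix.toLin' T₁) D) (n + 1) X -
          kernel 𝕜 (ExteriorAlgebra.map (Matrix.toLin' T₂) D) (n + 1) X‖ ≤
        ∑ Y : Fin (n + 1) → Γ₁', ‖kernel 𝕜 D (n + 1) Y‖ * ∑ j, ∏ i, f Y j i (X i) := by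
    intro X
    rw [kernel_map, kernel_map, ← sum_sub_distrib]
    refine (norm_sum_le _ _).trans (sum_le_sum fun Y _ => ?_)
    simp only [LinearMap.toMatrix'_toLin']
    rw [← sub_mul, norm_mul, mul_comm]
    refine mul_le_mul_of_nonneg_left ?_ (norm_nonneg _)
    have htel := norm_prod_sub_prod_le_sum_mul_prod_erase (univ : Finset (Fin (n + 1)))
      (f := fun i => T₁ (X i) (Y i)) (g := fun i => T₂ (X i) (Y i)) (M := fun i => Tm (X i) (Y i))
      (fun i _ => hT₁ _ _) (fun i _ => hT₂ _ _)
    refine htel.trans (le_of_eq (sum_congr rfl fun j _ => ?_))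
    rw [← mul_prod_erase univ (fun i => f Y j i (X i)) (mem_univ j)]
    simp only [hf, if_true]
    congr 1
    exact prod_congr rfl fun i hi => by rw [if_neg (ne_of_mem_erase hi)]
  -- the pinned out-sum of the `j`-th term factorises (when `j ≠ p` we have `n ≥ 1`: `card ((univ.erase p).erase j) + 1 = n`)
  have hX : ∀ (Y : Fin (n + 1) → Γ₁') (j : Fin (n + 1)),
      ∑ X ∈ Xp, ∏ i, f Y j i (X i) ≤ if j = p then a ^ n * ‖T₁ w (Y p) - T₂ w (Y p)‖ else
        δ * a ^ ((univ.erase p).erase j).card * Tm w (Y p) := by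
    intro Y j
    rw [hXp, sum_pinned_prod_eq (fun i x => f Y j i x) p w]
    by_cases hj : j = p
    · subst hj
      rw [if_pos rfl]
      have hfp : f Y j j w = ‖T₁ w (Y j) - T₂ w (Y j)‖ := by simp only [hf, if_true]
      rw [hfp, mul_comm]
      refine mul_le_mul_of_nonneg_right ?_ (norm_nonneg _)
      calc ∏ i ∈ univ.erase j, ∑ x, f Y j i x ≤ a ^ (univ.erase j).card :=
            prod_le_pow_card_of_le _ _ (fun i _ => sum_nonneg fun x _ => hf0 _ _ _ _) fun i hi => by
              have hij : i ≠ j := ne_of_mem_erase hi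
              simp only [hf, if_neg hij]
              exact hcol _
        _ = a ^ n := by rw [card_univ_erase_fin]
    · rw [if_neg hj]
      have hjm : j ∈ univ.erase p := mem_erase.2 ⟨hj, mem_univ _⟩
      have hfp : f Y j p w = Tm w (Y p) := by simp only [hf, if_neg (Ne.symm hj)]
      rw [hfp, ← mul_prod_erase _ _ hjm]
      have hfj : ∑ x, f Y j j x = ∑ x, ‖T₁ x (Y j) - T₂ x (Y j)‖ := by simp only [hf, if_true]
      rw [hfj]
      have h1 : ∑ x, ‖T₁ x (Y j) - T₂ x (Y j)‖ ≤ δ := hδcol _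
      have h2 : ∏ i ∈ (univ.erase p).erase j, ∑ x, f Y j i x ≤ a ^ ((univ.erase p).erase j).card :=
        prod_le_pow_card_of_le _ _ (fun i _ => sum_nonneg fun x _ => hf0 _ _ _ _) fun i hi => by
          have hij : i ≠ j := ne_of_mem_erase hi
          simp only [hf, if_neg hij]
          exact hcol _
      have h20 : 0 ≤ ∏ i ∈ (univ.erase p).erase j, ∑ x, f Y j i x :=
        prod_nonneg fun i _ => sum_nonneg fun x _ => hf0 _ _ _ _
      calc Tm w (Y p) * ((∑ x, ‖T₁ x (Y j) - T₂ x (Y j)‖) * ∏ i ∈ (univ.erase p).erase j, ∑ x, f Y j i x)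
          ≤ Tm w (Y p) * (δ * a ^ ((univ.erase p).erase j).card) :=
            mul_le_mul_of_nonneg_left (mul_le_mul h1 h2 h20 hδ) (hTm0 _ _)
        _ = δ * a ^ ((univ.erase p).erase j).card * Tm w (Y p) := by ring
  -- sum against the profile of `D`, leg `p` fibrewise
  have hsumY : ∀ j : Fin (n + 1),
      ∑ Y : Fin (n + 1) → Γ₁', ‖kernel 𝕜 D (n + 1) Y‖ * (∑ X ∈ Xp, ∏ i, f Y j i (X i)) ≤ a ^ n * δ * ND := by
    intro j
    by_cases hj : j = p
    · calc ∑ Y : Fin (n + 1) → Γ₁', ‖kernel 𝕜 D (n + 1) Y‖ * (∑ X ∈ Xp, ∏ i, f Y j i (X i))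
          ≤ ∑ Y : Fin (n + 1) → Γ₁', ‖kernel 𝕜 D (n + 1) Y‖ * (a ^ n * ‖T₁ w (Y p) - T₂ w (Y p)‖) :=
            sum_le_sum fun Y _ => mul_le_mul_of_nonneg_left (by simpa only [if_pos hj] using hX Y j) (norm_nonneg _)
        _ ≤ (∑ y, a ^ n * ‖T₁ w y - T₂ w y‖) * ND :=
            sum_mul_apply_leg_le (fun Y => ‖kernel 𝕜 D (n + 1) Y‖) (fun y => a ^ n * ‖T₁ w y - T₂ w y‖)
              (fun y => mul_nonneg (pow_nonneg ha n) (norm_nonneg _)) p hND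
        _ = a ^ n * (∑ y, ‖T₁ w y - T₂ w y‖) * ND := by rw [← mul_sum]
        _ ≤ a ^ n * δ * ND := by gcongr
    · have hjm : j ∈ univ.erase p := mem_erase.2 ⟨hj, mem_univ _⟩
      have hcard : ((univ.erase p).erase j).card + 1 = n := card_univ_erase_erase_fin hjm
      calc ∑ Y : Fin (n + 1) → Γ₁', ‖kernel 𝕜 D (n + 1) Y‖ * (∑ X ∈ Xp, ∏ i, f Y j i (X i))
          ≤ ∑ Y : Fin (n + 1) → Γ₁', ‖kernel 𝕜 D (n + 1) Y‖ * (δ * a ^ ((univ.erase p).erase j).card * Tm w (Y p)) :=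
            sum_le_sum fun Y _ => mul_le_mul_of_nonneg_left (by simpa only [if_neg hj] using hX Y j) (norm_nonneg _)
        _ ≤ (∑ y, δ * a ^ ((univ.erase p).erase j).card * Tm w y) * ND :=
            sum_mul_apply_leg_le (fun Y => ‖kernel 𝕜 D (n + 1) Y‖) (fun y => δ * a ^ ((univ.erase p).erase j).card * Tm w y)
              (fun y => mul_nonneg (mul_nonneg hδ (pow_nonneg ha _)) (hTm0 _ _)) p hND
        _ = δ * a ^ ((univ.erase p).erase j).card * (∑ y, Tm w y) * ND := by rw [← mul_sum]
        _ ≤ δ * a ^ ((univ.erase p).erase j).card * a * ND := by gcongr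
        _ = a ^ n * δ * ND := by
            have hpow : a ^ ((univ.erase p).erase j).card * a = a ^ n := by rw [← pow_succ, hcard]
            rw [← hpow]; ring
  -- assemble
  calc ∑ X ∈ Xp, ‖kernel 𝕜 (ExteriorAlgebra.map (Matrix.toLin' T₁) D) (n + 1) X -
          kernel 𝕜 (ExteriorAlgebra.map (Matrix.toLin' T₂) D) (n + 1) X‖
      ≤ ∑ X ∈ Xp, ∑ Y : Fin (n + 1) → Γ₁', ∑ j, ‖kernel 𝕜 D (n + 1) Y‖ * ∏ i, f Y j i (X i) :=
        sum_le_sum fun X _ => (hpt X).trans (le_of_eq (sum_congr rfl fun Y _ => mul_sum _ _ _))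
    _ = ∑ Y : Fin (n + 1) → Γ₁', ∑ X ∈ Xp, ∑ j, ‖kernel 𝕜 D (n + 1) Y‖ * ∏ i, f Y j i (X i) := sum_comm
    _ = ∑ Y : Fin (n + 1) → Γ₁', ∑ j, ∑ X ∈ Xp, ‖kernel 𝕜 D (n + 1) Y‖ * ∏ i, f Y j i (X i) :=
        sum_congr rfl fun Y _ => sum_comm
    _ = ∑ j, ∑ Y : Fin (n + 1) → Γ₁', ∑ X ∈ Xp, ‖kernel 𝕜 D (n + 1) Y‖ * ∏ i, f Y j i (X i) := sum_comm
    _ = ∑ j, ∑ Y : Fin (n + 1) → Γ₁', ‖kernel 𝕜 D (n + 1) Y‖ * (∑ X ∈ Xp, ∏ i, f Y j i (X i)) := by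
        simp_rw [mul_sum]
    _ ≤ ∑ _j : Fin (n + 1), a ^ n * δ * ND := sum_le_sum fun j _ => hsumY j
    _ = (n + 1) * a ^ n * δ * ND := by
        rw [sum_const, card_univ, Fintype.card_fin, nsmul_eq_mul]; push_cast; ring

/-- **The same bound for the kernels of the difference** `map T₁ D − map T₂ D`. [folklore] -/
theorem sum_pinned_norm_kernel_map_sub_map_le' (T₁ T₂ : Matrix Γ₂' Γ₁' 𝕜) (Tm : Γ₂' → Γ₁' → ℝ) (D : GrassmannAlgebra 𝕜 Γ₁') {n : ℕ}
    (p : Fin (n + 1)) (w : Γ₂') {a δ ND : ℝ} (ha : 0 ≤ a) (hδ : 0 ≤ δ) (hND0 : 0 ≤ ND)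
    (hT₁ : ∀ x y, ‖T₁ x y‖ ≤ Tm x y) (hT₂ : ∀ x y, ‖T₂ x y‖ ≤ Tm x y)
    (hcol : ∀ y, ∑ x, Tm x y ≤ a) (hrow : ∑ y, Tm w y ≤ a)
    (hδcol : ∀ y, ∑ x, ‖T₁ x y - T₂ x y‖ ≤ δ) (hδrow : ∑ y, ‖T₁ w y - T₂ w y‖ ≤ δ)
    (hND : ∀ y, ∑ Y ∈ univ.filter (fun Y : Fin (n + 1) → Γ₁' => Y p = y), ‖kernel 𝕜 D (n + 1) Y‖ ≤ ND) :
    ∑ X ∈ univ.filter (fun X : Fin (n + 1) → Γ₂' => X p = w),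
        ‖kernel 𝕜 (ExteriorAlgebra.map (Matrix.toLin' T₁) D - ExteriorAlgebra.map (Matrix.toLin' T₂) D) (n + 1) X‖ ≤
      (n + 1) * a ^ n * δ * ND := by
  refine le_trans (le_of_eq (sum_congr rfl fun X _ => ?_))
    (sum_pinned_norm_kernel_map_sub_map_le T₁ T₂ Tm D p w ha hδ hND0 hT₁ hT₂ hcol hrow hδcol hδrow hND)
  rw [sub_eq_add_neg, kernel_add, ← neg_one_smul 𝕜 (ExteriorAlgebra.map (Matrix.toLin' T₂) D), kernel_smul, neg_one_mul,
    ← sub_eq_add_neg]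

end Summit.HubbardSuperconductivity.HubbardSuperconductivity.Theorems.TwoVolumeDefect

end
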